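import Mathlib.InformationTheory.KullbackLeibler.Basic
import Mathlib.Analysis.SpecialFunctions.Log.Basic
import HarnessLib

/-!
# The entropy inequality for bounded functions (Donsker–Varadhan transfer)

Helper for the line `Sketch` of the crux `InformationPercolationEngine.PercolationClosesChaos`
(stmt-AtomisticToContinuum-15178), stub `stub_entropyEventTransfer`, consumed by `stub_dvTransfer`.

For probability measures `μ`, `ν` on a measurable space with `H(μ | ν) = klDiv μ ν < ∞`, a measurable
`B : E → [0, 1]` and `λ > 0`,

  `∫ B dμ ≤ (H(μ | ν) + log ∫ e^{λ B} dν) / λ`.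

This is the entropy inequality `⟨μ, f⟩ ≤ H(μ | ν) + log ⟨ν, e^f⟩` (Kipnis–Landim 1999, Appendix 1 §8;
Donsker–Varadhan) with `f = λ B`, obtained as `0 ≤ H(μ | ν_f)` for the tilted probability measure
`ν_f = e^f ν / ⟨ν, e^f⟩` (Mathlib's `Measure.tilted`, `integral_llr_tilted_right`,
`toReal_klDiv_of_measure_eq`); the argument is the one of
`Literature.Probability.Entropy.KipnisLandim1999_A1_8_2_holds` with `a 𝟙_A` replaced by `λ B`.

## References
* C. Kipnis, C. Landim, *Scaling Limits of Interacting Particle Systems*, Grundlehren 320,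
  Springer (1999), Appendix 1, §8 (entropy inequality).
-/

noncomputable section

namespace Summit.AtomisticToContinuum.HydrodynamicLimit.Theorems.ErgodicWindowLine

open MeasureTheory InformationTheory

/-- A measurable function with values in `[0, 1]`, scaled by `λ`, is integrable against a probability
measure. [folklore] -/
theorem integrable_const_mul_of_bounded {E : Type*} [MeasurableSpace E] (μ : Measure E)
    [IsProbabilityMeasure μ] (B : E → ℝ) (hB : Measurable B) (hB0 : ∀ x, 0 ≤ B x)
    (hB1 : ∀ x, B x ≤ 1) (lam : ℝ) : Integrable (fun x => lam * B x) μ := by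
  refine (integrable_const |lam|).mono' (hB.const_mul lam).aestronglyMeasurable ?_
  refine Filter.Eventually.of_forall fun x => ?_
  rw [Real.norm_eq_abs, abs_mul]
  calc |lam| * |B x| ≤ |lam| * 1 := by
        gcongr
        rw [abs_of_nonneg (hB0 x)]
        exact hB1 x
    _ = |lam| := mul_one _

/-- `exp (λ B)` is integrable against a probability measure for a measurable `B` with values in
`[0, 1]`. [folklore] -/
theorem integrable_exp_const_mul_of_bounded {E : Type*} [MeasurableSpace E] (ν : Measure E)
    [IsProbabilityMeasure ν] (B : E → ℝ) (hB : Measurable B) (hB0 : ∀ x, 0 ≤ B x)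
    (hB1 : ∀ x, B x ≤ 1) (lam : ℝ) : Integrable (fun x => Real.exp (lam * B x)) ν := by
  refine (integrable_const (Real.exp |lam|)).mono'
    (hB.const_mul lam).exp.aestronglyMeasurable ?_
  refine Filter.Eventually.of_forall fun x => ?_
  rw [Real.norm_eq_abs, Real.abs_exp, Real.exp_le_exp]
  calc lam * B x ≤ |lam * B x| := le_abs_self _
    _ = |lam| * |B x| := abs_mul _ _
    _ ≤ |lam| * 1 := by
        gcongr
        rw [abs_of_nonneg (hB0 x)]
        exact hB1 x
    _ = |lam| := mul_one _

/-- **The entropy inequality for bounded functions** (Kipnis–Landim 1999, Appendix 1 §8;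
Donsker–Varadhan): for probability measures `μ`, `ν` with `H(μ | ν) = klDiv μ ν < ∞`, a measurable
`B` with `0 ≤ B ≤ 1` and `λ > 0`, `∫ B dμ ≤ (H(μ | ν) + log ∫ e^{λ B} dν) / λ`. Proof: `0 ≤ H(μ | ν_f)`
for the tilted measure `ν_f`, `f = λ B`, and `H(μ | ν_f) = H(μ | ν) - ∫ f dμ + log ∫ e^f dν`
(`integral_llr_tilted_right`). -/
theorem stub_entropyEventTransfer {E : Type*} [MeasurableSpace E] (μ ν : Measure E) [IsProbabilityMeasure μ]
    [IsProbabilityMeasure ν] (B : E → ℝ) (hB : Measurable B) (hB0 : ∀ x, 0 ≤ B x) (hB1 : ∀ x, B x ≤ 1)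
    (lam : ℝ) (hlam : 0 < lam) (hH : InformationTheory.klDiv μ ν ≠ ⊤) :
    ∫ x, B x ∂μ ≤ ((InformationTheory.klDiv μ ν).toReal + Real.log (∫ x, Real.exp (lam * B x) ∂ν)) / lam := by
  obtain ⟨hμν, h_int⟩ := klDiv_ne_top_iff.mp hH
  set f : E → ℝ := fun x => lam * B x with hf_def
  have hfμ : Integrable f μ := integrable_const_mul_of_bounded μ B hB hB0 hB1 lam
  have hfν : Integrable (fun x => Real.exp (f x)) ν :=
    integrable_exp_const_mul_of_bounded ν B hB hB0 hB1 lam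
  have hint_f : ∫ x, f x ∂μ = lam * ∫ x, B x ∂μ := integral_const_mul lam B
  -- The tilted measure `ν.tilted f` is a probability measure with `μ ≪ ν.tilted f`.
  haveI : IsProbabilityMeasure (ν.tilted f) := isProbabilityMeasure_tilted hfν
  have hμ_tilt : μ ≪ ν.tilted f := hμν.trans (absolutelyContinuous_tilted hfν)
  -- `0 ≤ H(μ | ν.tilted f) = H(μ | ν) - ∫ f dμ + log ∫ e^f dν`.
  have h_nonneg : 0 ≤ ∫ x, llr μ (ν.tilted f) x ∂μ := by
    rw [← toReal_klDiv_of_measure_eq hμ_tilt (by simp)]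
    exact ENNReal.toReal_nonneg
  rw [integral_llr_tilted_right hμν hfμ hfν h_int, hint_f,
    ← toReal_klDiv_of_measure_eq hμν (by simp)] at h_nonneg
  rw [le_div_iff₀ hlam]
  have : (fun x => Real.exp (f x)) = fun x => Real.exp (lam * B x) := rfl
  rw [this] at h_nonneg
  linarith

end Summit.AtomisticToContinuum.HydrodynamicLimit.Theorems.ErgodicWindowLine

end
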